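import Literature.AnabelianGeometry.SemiGraphs.TemperedCoverings
import Literature.AnabelianGeometry.SemiGraphs.TemperoidsHomProofs
import Mathlib.CategoryTheory.Limits.Preserves.Finite
import HarnessLib

/-!
# [SemiAnbd] §3: finite limits and countable colimits in `B^cov(G)`, componentwise (G10 brick B0)

Mochizuki, *Semi-graphs of anabelioids*, Publ. RIMS **42** (2006) 221–322, §3, manuscript
pp. 36–39 [cite: MochizukiSemiAnbd2006, §3 pp.36-39]: `B^cov(G)` ("objects given by data
`{S_v, φ_e}` … morphisms given by morphisms between such data", p. 36), its full subcategory
`B^temp(G)` (Def. 3.5 (ii) p. 37) and the statements of Proposition 3.6 (ii)/(iv) ("`B^temp(G)` is a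
connected temperoid", "any morphism … induces a morphism of temperoids", pp. 38–39) all use that
`B^cov(G)` has the finite limits (and countable colimits) of a temperoid and that they are computed
fibre by fibre.  Proof-only companion (no definitions) of `TemperedCoverings.lean` (seat
abc-iut-L3-t2, frozen v2): for every FINITE shape `J` (and, dually, every COUNTABLE shape `J` for
colimits — `CovObj.exists_colimitCocone`, `CovObj.hasColimitsOfShape`,
`CovObj.preservesColimitsOfShape_restrictV/E`, via `temperedAction_isClosedUnderColimitsOfShape` and
`btempRes_preservesColimitsOfShape`),

* `CovObj.exists_limitCone` — every `K : J ⥤ B^cov(G)` has a limit cone whose vertex objects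
  `L_v = lim_j (K j)_v` and edge objects `L_e = lim_j (K j)_e` are the limits in `B^temp(Π_v)`,
  `B^temp(Π_e)` (which exist: `B^temp(Π)` is closed under finite limits of `Π`-sets,
  `temperedAction_isClosedUnderLimitsOfShape`, seat L3-d2), glued by the limit of the gluings
  (`B^temp(b_*)` preserves finite limits, `btempRes_preservesLimitsOfShape`);
* `CovObj.hasLimitsOfShape`, `CovObj.hasFiniteLimits` — hence `B^cov(G)` has finite limits;
* `CovObj.preservesLimitsOfShape_restrictV` / `…_restrictE` — the restriction functors
  `S ↦ S_v`, `S ↦ S_e` preserve them (so every limit cone is componentwise a limit cone).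

abc-iut G10 ladder infrastructure (brick B0, L3-lead 20:21:29Z); the closure of the tempered
objects `B^temp(G)` under these (co)limits is the sibling file.  Plain category theory; no statement of the
paper is strengthened.
-/

open CategoryTheory CategoryTheory.Limits Topology

namespace Literature.AnabelianGeometry.SemiGraphs

namespace ProfiniteSemiGraph

universe u

variable {𝒢 : ProfiniteSemiGraph.{u}}

namespace CovObj

/-! ### Finite limits in `B^temp(Π)` (from the closure property of seat L3-d2) -/

/-- `B^temp(Π)` has finite limits (it is closed under them inside the category of all `Π`-sets).
[cite: MochizukiSemiAnbd2006, Def 3.1(iii) p.33] -/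
theorem hasLimitsOfShape_bTemp (G : Type u) [Group G] [TopologicalSpace G] (J : Type)
    [SmallCategory J] [FinCategory J] : HasLimitsOfShape J (BTemp G) :=
  haveI := temperedAction_isClosedUnderLimitsOfShape (G := G) J
  inferInstance

section Limits

variable {J : Type} [SmallCategory J] [FinCategory J]

/-- Two morphisms of `B^cov(G)` with the same vertex and edge components are equal.
[cite: MochizukiSemiAnbd2006, §3 p.36] -/
theorem hom_ext' {S T : CovObj 𝒢} (f g : S ⟶ T) (hV : ∀ v, f.fV v = g.fV v)
    (hE : ∀ e, f.fE e = g.fE e) : f = g :=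
  CovHom.ext (funext hV) (funext hE)

/-- **Finite limits in `B^cov(G)`, componentwise.**  Every finite diagram `K : J ⥤ B^cov(G)` has a
limit cone which the restriction functors `S ↦ S_v`, `S ↦ S_e` map to limit cones of
`B^temp(Π_v)`, `B^temp(Π_e)`. [cite: MochizukiSemiAnbd2006, §3 p.36] -/
theorem exists_limitCone (K : J ⥤ CovObj 𝒢) :
    ∃ (c : Cone K) (_ : IsLimit c), (∀ v, Nonempty (IsLimit ((restrictV 𝒢 v).mapCone c))) ∧
      ∀ e, Nonempty (IsLimit ((restrictE 𝒢 e).mapCone c)) := by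
  classical
  haveI : ∀ v, HasLimitsOfShape J (BTemp (𝒢.Gv v)) := fun v => hasLimitsOfShape_bTemp _ J
  haveI : ∀ e, HasLimitsOfShape J (BTemp (𝒢.Ge e)) := fun e => hasLimitsOfShape_bTemp _ J
  haveI : ∀ (b : 𝒢.graph.Branch) (v : 𝒢.graph.Vertex) (h : 𝒢.graph.abuts b = some v),
      PreservesLimitsOfShape J (BTemp.res (𝒢.brHom b v h)) :=
    fun b v h => btempRes_preservesLimitsOfShape _ J
  -- notation
  let F : ∀ v : 𝒢.graph.Vertex, J ⥤ BTemp (𝒢.Gv v) := fun v => K ⋙ restrictV 𝒢 v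
  let E : ∀ e : 𝒢.graph.Edge, J ⥤ BTemp (𝒢.Ge e) := fun e => K ⋙ restrictE 𝒢 e
  -- the gluings of the `K j` assemble to natural isomorphisms
  let α : ∀ (b : 𝒢.graph.Branch) (v : 𝒢.graph.Vertex) (h : 𝒢.graph.abuts b = some v),
      E (𝒢.graph.edgeOf b) ≅ F v ⋙ BTemp.res (𝒢.brHom b v h) := fun b v h =>
    NatIso.ofComponents (fun j => (K.obj j).glue b v h) (fun {i j} f => (K.map f).comm b v h)
  -- the limit object
  let L : CovObj 𝒢 :=
    { SV := fun v => limit (F v)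
      SE := fun e => limit (E e)
      glue := fun b v h =>
        HasLimit.isoOfNatIso (α b v h) ≪≫ (preservesLimitIso (BTemp.res (𝒢.brHom b v h)) (F v)).symm }
  have hLglue : ∀ (b : 𝒢.graph.Branch) (v : 𝒢.graph.Vertex) (h : 𝒢.graph.abuts b = some v),
      (L.glue b v h).hom =
        (HasLimit.isoOfNatIso (α b v h)).hom ≫ (preservesLimitIso (BTemp.res (𝒢.brHom b v h)) (F v)).inv :=
    fun b v h => rfl
  -- the projections
  let π : ∀ j : J, L ⟶ K.obj j := fun j =>
    { fV := fun v => limit.π (F v) j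
      fE := fun e => limit.π (E e) j
      comm := fun b v h => by
        rw [hLglue, Category.assoc]
        exact (HasLimit.isoOfNatIso_hom_π (α b v h) j).symm.trans
          (congrArg (fun t => (HasLimit.isoOfNatIso (α b v h)).hom ≫ t)
            (preservesLimitIso_inv_π (BTemp.res (𝒢.brHom b v h)) (F v) j).symm) }
  let c : Cone K :=
    { pt := L
      π :=
        { app := π
          naturality := fun {i j} f => by
            apply hom_ext'
            · intro v
              change 𝟙 _ ≫ limit.π (F v) j = limit.π (F v) i ≫ (K.map f).fV v
              rw [Category.id_comp]
              exact (limit.w (F v) f).symm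
            · intro e
              change 𝟙 _ ≫ limit.π (E e) j = limit.π (E e) i ≫ (K.map f).fE e
              rw [Category.id_comp]
              exact (limit.w (E e) f).symm } }
  -- the universal property, componentwise
  have hc : IsLimit c :=
    { lift := fun s =>
        { fV := fun v => limit.lift (F v) ((restrictV 𝒢 v).mapCone s)
          fE := fun e => limit.lift (E e) ((restrictE 𝒢 e).mapCone s)
          comm := fun b v h => by
            rw [hLglue, ← Category.assoc, Iso.comp_inv_eq]
            apply limit.hom_ext
            intro j
            have h1 : (BTemp.res (𝒢.brHom b v h)).map (limit.lift (F v) ((restrictV 𝒢 v).mapCone s)) ≫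
                (BTemp.res (𝒢.brHom b v h)).map (limit.π (F v) j) =
                  (BTemp.res (𝒢.brHom b v h)).map ((s.π.app j).fV v) := by
              rw [← Functor.map_comp, limit.lift_π]
              rfl
            have h2 : limit.lift (E (𝒢.graph.edgeOf b)) ((restrictE 𝒢 (𝒢.graph.edgeOf b)).mapCone s) ≫
                limit.π (E (𝒢.graph.edgeOf b)) j = (s.π.app j).fE (𝒢.graph.edgeOf b) :=
              limit.lift_π _ j
            have eL : limit.lift (E (𝒢.graph.edgeOf b)) ((restrictE 𝒢 (𝒢.graph.edgeOf b)).mapCone s) ≫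
                ((HasLimit.isoOfNatIso (α b v h)).hom ≫
                  limit.π (F v ⋙ BTemp.res (𝒢.brHom b v h)) j) =
                (s.π.app j).fE (𝒢.graph.edgeOf b) ≫ (α b v h).hom.app j :=
              (congrArg (fun t => limit.lift (E (𝒢.graph.edgeOf b))
                  ((restrictE 𝒢 (𝒢.graph.edgeOf b)).mapCone s) ≫ t)
                (HasLimit.isoOfNatIso_hom_π (α b v h) j)).trans
                ((Category.assoc _ _ _).symm.trans (congrArg (· ≫ (α b v h).hom.app j) h2))
            have eR : (s.pt.glue b v h).hom ≫
                ((BTemp.res (𝒢.brHom b v h)).map (limit.lift (F v) ((restrictV 𝒢 v).mapCone s)) ≫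
                  ((preservesLimitIso (BTemp.res (𝒢.brHom b v h)) (F v)).hom ≫
                    limit.π (F v ⋙ BTemp.res (𝒢.brHom b v h)) j)) =
                (s.pt.glue b v h).hom ≫ (BTemp.res (𝒢.brHom b v h)).map ((s.π.app j).fV v) :=
              (congrArg (fun t => (s.pt.glue b v h).hom ≫
                  ((BTemp.res (𝒢.brHom b v h)).map (limit.lift (F v) ((restrictV 𝒢 v).mapCone s)) ≫ t))
                (preservesLimitIso_hom_π (BTemp.res (𝒢.brHom b v h)) (F v) j)).trans
                (congrArg (fun t => (s.pt.glue b v h).hom ≫ t) h1)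
            simp only [Category.assoc]
            exact eL.trans (((s.π.app j).comm b v h).trans eR.symm) }
      fac := fun s j => by
        apply hom_ext'
        · intro v
          exact limit.lift_π ((restrictV 𝒢 v).mapCone s) j
        · intro e
          exact limit.lift_π ((restrictE 𝒢 e).mapCone s) j
      uniq := fun s m hm => by
        apply hom_ext'
        · intro v
          apply limit.hom_ext
          intro j
          exact (congrArg (fun k : s.pt ⟶ K.obj j => k.fV v) (hm j)).trans
            (limit.lift_π ((restrictV 𝒢 v).mapCone s) j).symm
        · intro e
          apply limit.hom_ext
          intro j
          exact (congrArg (fun k : s.pt ⟶ K.obj j => k.fE e) (hm j)).trans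
            (limit.lift_π ((restrictE 𝒢 e).mapCone s) j).symm }
  refine ⟨c, hc, fun v => ⟨?_⟩, fun e => ⟨?_⟩⟩
  · exact IsLimit.ofIsoLimit (limit.isLimit (F v))
      (Cone.ext (Iso.refl _) fun j => (Category.id_comp _).symm)
  · exact IsLimit.ofIsoLimit (limit.isLimit (E e))
      (Cone.ext (Iso.refl _) fun j => (Category.id_comp _).symm)

/-- `B^cov(G)` has limits of every finite shape. [cite: MochizukiSemiAnbd2006, §3 p.36] -/
theorem hasLimitsOfShape : HasLimitsOfShape J (CovObj 𝒢) :=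
  ⟨fun K => by
    obtain ⟨c, hc, -⟩ := exists_limitCone K
    exact ⟨⟨⟨c, hc⟩⟩⟩⟩

variable (𝒢) in
/-- The restriction `B^cov(G) ⥤ B^temp(Π_v)`, `S ↦ S_v`, preserves finite limits.
[cite: MochizukiSemiAnbd2006, Def 3.5(ii) p.37] -/
theorem preservesLimitsOfShape_restrictV (v : 𝒢.graph.Vertex) :
    PreservesLimitsOfShape J (restrictV 𝒢 v) :=
  ⟨fun {K} => by
    obtain ⟨c, hc, hV, -⟩ := exists_limitCone K
    exact preservesLimit_of_preserves_limit_cone hc (hV v).some⟩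

variable (𝒢) in
/-- The restriction `B^cov(G) ⥤ B^temp(Π_e)`, `S ↦ S_e`, preserves finite limits.
[cite: MochizukiSemiAnbd2006, Def 3.5(ii) p.37] -/
theorem preservesLimitsOfShape_restrictE (e : 𝒢.graph.Edge) :
    PreservesLimitsOfShape J (restrictE 𝒢 e) :=
  ⟨fun {K} => by
    obtain ⟨c, hc, -, hE⟩ := exists_limitCone K
    exact preservesLimit_of_preserves_limit_cone hc (hE e).some⟩

end Limits

/-- `B^cov(G)` has finite limits. [cite: MochizukiSemiAnbd2006, §3 p.36] -/
theorem hasFiniteLimits : HasFiniteLimits (CovObj 𝒢) :=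
  ⟨fun _ _ _ => hasLimitsOfShape⟩

variable (𝒢) in
/-- `S ↦ S_v` preserves finite limits. [cite: MochizukiSemiAnbd2006, Def 3.5(ii) p.37] -/
theorem preservesFiniteLimits_restrictV (v : 𝒢.graph.Vertex) :
    PreservesFiniteLimits (restrictV 𝒢 v) :=
  ⟨fun _ _ _ => preservesLimitsOfShape_restrictV 𝒢 v⟩

variable (𝒢) in
/-- `S ↦ S_e` preserves finite limits. [cite: MochizukiSemiAnbd2006, Def 3.5(ii) p.37] -/
theorem preservesFiniteLimits_restrictE (e : 𝒢.graph.Edge) :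
    PreservesFiniteLimits (restrictE 𝒢 e) :=
  ⟨fun _ _ _ => preservesLimitsOfShape_restrictE 𝒢 e⟩

/-! ### Countable colimits in `B^temp(Π)` and in `B^cov(G)` -/

/-- `B^temp(Π)` has countable colimits (it is closed under them inside the category of all
`Π`-sets, for `Π` a topological group). [cite: MochizukiSemiAnbd2006, Def 3.1(iii) p.33] -/
theorem hasColimitsOfShape_bTemp (G : Type u) [Group G] [TopologicalSpace G] [IsTopologicalGroup G]
    (J : Type) [SmallCategory J] [CountableCategory J] : HasColimitsOfShape J (BTemp G) :=
  haveI := temperedAction_isClosedUnderColimitsOfShape (G := G) J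
  inferInstance

section Colimits

variable {J : Type} [SmallCategory J] [CountableCategory J]

/-- **Countable colimits in `B^cov(G)`, componentwise.**  Every countable diagram
`K : J ⥤ B^cov(G)` has a colimit cocone which the restriction functors `S ↦ S_v`, `S ↦ S_e` map to
colimit cocones of `B^temp(Π_v)`, `B^temp(Π_e)`. [cite: MochizukiSemiAnbd2006, §3 p.36] -/
theorem exists_colimitCocone (K : J ⥤ CovObj 𝒢) :
    ∃ (c : Cocone K) (_ : IsColimit c), (∀ v, Nonempty (IsColimit ((restrictV 𝒢 v).mapCocone c))) ∧
      ∀ e, Nonempty (IsColimit ((restrictE 𝒢 e).mapCocone c)) := by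
  classical
  haveI : ∀ v, HasColimitsOfShape J (BTemp (𝒢.Gv v)) := fun v => hasColimitsOfShape_bTemp _ J
  haveI : ∀ e, HasColimitsOfShape J (BTemp (𝒢.Ge e)) := fun e => hasColimitsOfShape_bTemp _ J
  haveI : ∀ (b : 𝒢.graph.Branch) (v : 𝒢.graph.Vertex) (h : 𝒢.graph.abuts b = some v),
      PreservesColimitsOfShape J (BTemp.res (𝒢.brHom b v h)) :=
    fun b v h => btempRes_preservesColimitsOfShape _ J
  let F : ∀ v : 𝒢.graph.Vertex, J ⥤ BTemp (𝒢.Gv v) := fun v => K ⋙ restrictV 𝒢 v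
  let E : ∀ e : 𝒢.graph.Edge, J ⥤ BTemp (𝒢.Ge e) := fun e => K ⋙ restrictE 𝒢 e
  let α : ∀ (b : 𝒢.graph.Branch) (v : 𝒢.graph.Vertex) (h : 𝒢.graph.abuts b = some v),
      E (𝒢.graph.edgeOf b) ≅ F v ⋙ BTemp.res (𝒢.brHom b v h) := fun b v h =>
    NatIso.ofComponents (fun j => (K.obj j).glue b v h) (fun {i j} f => (K.map f).comm b v h)
  -- the colimit object and the coprojections
  let L : CovObj 𝒢 :=
    { SV := fun v => colimit (F v)
      SE := fun e => colimit (E e)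
      glue := fun b v h =>
        HasColimit.isoOfNatIso (α b v h) ≪≫
          (preservesColimitIso (BTemp.res (𝒢.brHom b v h)) (F v)).symm }
  have hLglue : ∀ (b : 𝒢.graph.Branch) (v : 𝒢.graph.Vertex) (h : 𝒢.graph.abuts b = some v),
      (L.glue b v h).hom = (HasColimit.isoOfNatIso (α b v h)).hom ≫
        (preservesColimitIso (BTemp.res (𝒢.brHom b v h)) (F v)).inv :=
    fun b v h => rfl
  let ι : ∀ j : J, K.obj j ⟶ L := fun j =>
    { fV := fun v => colimit.ι (F v) j
      fE := fun e => colimit.ι (E e) j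
      comm := fun b v h => by
        rw [hLglue, ← Category.assoc]
        exact (congrArg (· ≫ (preservesColimitIso (BTemp.res (𝒢.brHom b v h)) (F v)).inv)
          (HasColimit.isoOfNatIso_ι_hom (α b v h) j)).trans ((Category.assoc _ _ _).trans
            (congrArg (fun t => (α b v h).hom.app j ≫ t)
              (ι_preservesColimitIso_inv (BTemp.res (𝒢.brHom b v h)) (F v) j))) }
  let c : Cocone K :=
    { pt := L
      ι :=
        { app := ι
          naturality := fun {i j} f => by
            apply hom_ext'
            · intro v
              change (K.map f).fV v ≫ colimit.ι (F v) j = colimit.ι (F v) i ≫ 𝟙 _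
              rw [Category.comp_id]
              exact colimit.w (F v) f
            · intro e
              change (K.map f).fE e ≫ colimit.ι (E e) j = colimit.ι (E e) i ≫ 𝟙 _
              rw [Category.comp_id]
              exact colimit.w (E e) f } }
  have hc : IsColimit c :=
    { desc := fun s =>
        { fV := fun v => colimit.desc (F v) ((restrictV 𝒢 v).mapCocone s)
          fE := fun e => colimit.desc (E e) ((restrictE 𝒢 e).mapCocone s)
          comm := fun b v h => by
            rw [hLglue, Category.assoc]
            apply colimit.hom_ext
            intro j
            have h1 : (BTemp.res (𝒢.brHom b v h)).map (colimit.ι (F v) j) ≫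
                (BTemp.res (𝒢.brHom b v h)).map (colimit.desc (F v) ((restrictV 𝒢 v).mapCocone s)) =
                  (BTemp.res (𝒢.brHom b v h)).map ((s.ι.app j).fV v) := by
              rw [← Functor.map_comp, colimit.ι_desc]
              rfl
            have h2 : colimit.ι (E (𝒢.graph.edgeOf b)) j ≫
                colimit.desc (E (𝒢.graph.edgeOf b)) ((restrictE 𝒢 (𝒢.graph.edgeOf b)).mapCocone s) =
                  (s.ι.app j).fE (𝒢.graph.edgeOf b) :=
              colimit.ι_desc _ j
            -- left-hand side: `ι_j ≫ desc ≫ glue_s = fE_j ≫ glue_s`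
            have eL : colimit.ι (E (𝒢.graph.edgeOf b)) j ≫
                (colimit.desc (E (𝒢.graph.edgeOf b)) ((restrictE 𝒢 (𝒢.graph.edgeOf b)).mapCocone s) ≫
                  (s.pt.glue b v h).hom) =
                (s.ι.app j).fE (𝒢.graph.edgeOf b) ≫ (s.pt.glue b v h).hom :=
              (Category.assoc _ _ _).symm.trans (congrArg (· ≫ (s.pt.glue b v h).hom) h2)
            -- right-hand side: `ι_j ≫ iso ≫ iso⁻¹ ≫ res(desc) = glue_j ≫ res(fV_j)`
            have eR : colimit.ι (E (𝒢.graph.edgeOf b)) j ≫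
                ((HasColimit.isoOfNatIso (α b v h)).hom ≫
                  ((preservesColimitIso (BTemp.res (𝒢.brHom b v h)) (F v)).inv ≫
                    (BTemp.res (𝒢.brHom b v h)).map
                      (colimit.desc (F v) ((restrictV 𝒢 v).mapCocone s)))) =
                (α b v h).hom.app j ≫ (BTemp.res (𝒢.brHom b v h)).map ((s.ι.app j).fV v) := by
              rw [← Category.assoc, HasColimit.isoOfNatIso_ι_hom, Category.assoc, ← Category.assoc
                (colimit.ι _ j), ι_preservesColimitIso_inv]
              exact congrArg (fun t => (α b v h).hom.app j ≫ t) h1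
            exact eL.trans (((s.ι.app j).comm b v h).trans eR.symm) }
      fac := fun s j => by
        apply hom_ext'
        · intro v
          exact colimit.ι_desc ((restrictV 𝒢 v).mapCocone s) j
        · intro e
          exact colimit.ι_desc ((restrictE 𝒢 e).mapCocone s) j
      uniq := fun s m hm => by
        apply hom_ext'
        · intro v
          apply colimit.hom_ext
          intro j
          exact (congrArg (fun k : K.obj j ⟶ s.pt => k.fV v) (hm j)).trans
            (colimit.ι_desc ((restrictV 𝒢 v).mapCocone s) j).symm
        · intro e
          apply colimit.hom_ext
          intro j
          exact (congrArg (fun k : K.obj j ⟶ s.pt => k.fE e) (hm j)).trans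
            (colimit.ι_desc ((restrictE 𝒢 e).mapCocone s) j).symm }
  refine ⟨c, hc, fun v => ⟨?_⟩, fun e => ⟨?_⟩⟩
  · exact IsColimit.ofIsoColimit (colimit.isColimit (F v))
      (Cocone.ext (Iso.refl _) fun j => Category.comp_id _)
  · exact IsColimit.ofIsoColimit (colimit.isColimit (E e))
      (Cocone.ext (Iso.refl _) fun j => Category.comp_id _)

/-- `B^cov(G)` has colimits of every countable shape. [cite: MochizukiSemiAnbd2006, §3 p.36] -/
theorem hasColimitsOfShape : HasColimitsOfShape J (CovObj 𝒢) :=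
  ⟨fun K => by
    obtain ⟨c, hc, -⟩ := exists_colimitCocone K
    exact ⟨⟨⟨c, hc⟩⟩⟩⟩

variable (𝒢) in
/-- The restriction `B^cov(G) ⥤ B^temp(Π_v)`, `S ↦ S_v`, preserves countable colimits.
[cite: MochizukiSemiAnbd2006, Def 3.5(ii) p.37] -/
theorem preservesColimitsOfShape_restrictV (v : 𝒢.graph.Vertex) :
    PreservesColimitsOfShape J (restrictV 𝒢 v) :=
  ⟨fun {K} => by
    obtain ⟨c, hc, hV, -⟩ := exists_colimitCocone K
    exact preservesColimit_of_preserves_colimit_cocone hc (hV v).some⟩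

variable (𝒢) in
/-- The restriction `B^cov(G) ⥤ B^temp(Π_e)`, `S ↦ S_e`, preserves countable colimits.
[cite: MochizukiSemiAnbd2006, Def 3.5(ii) p.37] -/
theorem preservesColimitsOfShape_restrictE (e : 𝒢.graph.Edge) :
    PreservesColimitsOfShape J (restrictE 𝒢 e) :=
  ⟨fun {K} => by
    obtain ⟨c, hc, -, hE⟩ := exists_colimitCocone K
    exact preservesColimit_of_preserves_colimit_cocone hc (hE e).some⟩

end Colimits

end CovObj

end ProfiniteSemiGraph

end Literature.AnabelianGeometry.SemiGraphs
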